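import Summits.NavierStokesRegularity.NavierStokesRegularity.Theorems.PerpetualPumpEulerTypeIGlueFourierDeriv
import Summits.NavierStokesRegularity.NavierStokesRegularity.Theorems.PerpetualPumpEulerTypeIGlueFourierIterated
import Mathlib.Analysis.Fourier.LpSpace
import Mathlib.Algebra.Order.Chebyshev
import Literature.Analysis.FluidPDE.TaoAveragedConjugation
import Mathlib.Analysis.Calculus.LineDeriv.IntegrationByParts
import Mathlib.Analysis.Distribution.AEEqOfIntegralContDiff
import HarnessLib

/-!
# Route PerpetualPump · `EulerTypeIGlue` — `ℝ³`: Fourier–Sobolev norms of smooth `H^N` fields and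
# `H¹⁰_df` membership of complexified classical velocity fields

Support file for the support item `EulerTypeIGlue` (stmt-NavierStokesRegularity-1838).  For a
smooth real field `u : ℝ³ → ℝ³` with `u, Du, …, D^N u ∈ L²` the `L²` class of `u^ℂ` has
`‖[u^ℂ]‖²_{H^N} ≤ 2^N (∫|u|² + 3^N ∫‖D^N u‖²)` in Tao's Fourier-side norm
(`eFourierSobolevNorm_sq_le`; binomial bound `(1+|ξ|²)^N ≤ 2^N(1 + 3^N Σᵢ ξᵢ^{2N})` and the
directional Plancherel identities of toolkit III with the derivative rule of toolkit II);
if moreover `div u = 0` then `ξ · 𝓕[u^ℂ](ξ) = 0` a.e. (`isFourierDivFree_toLp_complexify`), so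
`[u^ℂ] ∈ H¹⁰_df` (`memH10df_toLp_complexify`) — the regularity class of Tao 2016, §1.1.

## References

* T. Tao, J. Amer. Math. Soc. 29 (2016), arXiv:1402.0290v3, §1.1 p. 3 (`H¹⁰_df`). [Tao2016AveragedNS]
* E. M. Stein, G. Weiss, *Introduction to Fourier Analysis on Euclidean Spaces* (1971), Ch. I,
  Thm. 1.8, Thm. 2.3.
-/

noncomputable section

open MeasureTheory Set Filter Topology FourierTransform SchwartzMap TemperedDistribution
open scoped ENNReal NNReal FourierTransform RealInnerProductSpace ContDiff LineDeriv

set_option linter.dupNamespace false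

namespace Summit.NavierStokesRegularity.NavierStokesRegularity.Theorems.PerpetualPumpEulerTypeIGlue

/-! ### `ℝ³`: Fourier–Sobolev norms of smooth `H^N` vector fields, and `H¹⁰_df` membership -/

section R3

open Literature.Analysis.FluidPDE Literature.Analysis.FluidPDE.Tao2016
open Literature.Analysis.FunctionSpaces (eFourierSobolevNorm)
open Literature.Analysis.FunctionSpaces.EuclideanSpace (complexify complexify_apply norm_complexify
  continuous_complexify)

/-- **The Sobolev weight against coordinate monomials**:
`(1+|ξ|²)^{n+1} ≤ 2^{n+1} (1 + 3ⁿ Σᵢ ξᵢ^{2(n+1)})` on `ℝ³`. [folklore] -/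
theorem one_add_norm_sq_pow_le (n : ℕ) (ξ : EuclideanSpace ℝ (Fin 3)) :
    (1 + ‖ξ‖ ^ 2) ^ (n + 1) ≤ 2 ^ (n + 1) * (1 + 3 ^ n * ∑ i, (ξ i) ^ (2 * (n + 1))) := by
  set a : ℝ := ‖ξ‖ ^ 2 with ha_def
  have ha : 0 ≤ a := sq_nonneg _
  have hsum : a = ∑ i, (ξ i) ^ 2 := EuclideanSpace.real_norm_sq_eq ξ
  have h1 : (1 + a) ^ (n + 1) ≤ 2 ^ (n + 1) * max 1 a ^ (n + 1) := by
    rw [← mul_pow]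
    refine pow_le_pow_left₀ (by positivity) ?_ _
    have h₁ := le_max_left 1 a
    have h₂ := le_max_right 1 a
    linarith
  have h2 : max 1 a ^ (n + 1) ≤ 1 + a ^ (n + 1) := by
    rcases le_total 1 a with h | h
    · rw [max_eq_right h]
      linarith [pow_nonneg ha (n + 1)]
    · rw [max_eq_left h, one_pow]
      linarith [pow_nonneg ha (n + 1)]
  have h3 : a ^ (n + 1) ≤ 3 ^ n * ∑ i, (ξ i) ^ (2 * (n + 1)) := by
    rw [hsum]
    have h := pow_sum_le_card_mul_sum_pow (s := Finset.univ) (f := fun i : Fin 3 => (ξ i) ^ 2)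
      (fun i _ => sq_nonneg _) n
    simp only [Finset.card_univ, Fintype.card_fin, Nat.cast_ofNat, ← pow_mul] at h
    exact h
  calc (1 + a) ^ (n + 1) ≤ 2 ^ (n + 1) * max 1 a ^ (n + 1) := h1
    _ ≤ 2 ^ (n + 1) * (1 + a ^ (n + 1)) := by gcongr
    _ ≤ 2 ^ (n + 1) * (1 + 3 ^ n * ∑ i, (ξ i) ^ (2 * (n + 1))) := by gcongr

variable {u : EuclideanSpace ℝ (Fin 3) → EuclideanSpace ℝ (Fin 3)}

/-- Smoothness of the complexified field. [folklore] -/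
theorem contDiff_complexify_comp {n : WithTop ℕ∞} (hu : ContDiff ℝ n u) : ContDiff ℝ n (complexify ∘ u) :=
  complexify.toContinuousLinearMap.contDiff.comp hu

/-- Iterated derivatives of the complexified field: `Dⁿ(u^ℂ) = complexify ∘ Dⁿu`. [folklore] -/
theorem iteratedFDeriv_complexify_comp (hu : ContDiff ℝ (⊤ : ℕ∞) u) (n : ℕ) (x : EuclideanSpace ℝ (Fin 3)) :
    iteratedFDeriv ℝ n (complexify ∘ u) x =
      complexify.toContinuousLinearMap.compContinuousMultilinearMap (iteratedFDeriv ℝ n u x) :=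
  complexify.toContinuousLinearMap.iteratedFDeriv_comp_left hu.contDiffAt (mod_cast le_top)

/-- The complexification does not increase the size of the iterated derivatives. [folklore] -/
theorem norm_iteratedFDeriv_complexify_comp_le (hu : ContDiff ℝ (⊤ : ℕ∞) u) (n : ℕ)
    (x : EuclideanSpace ℝ (Fin 3)) :
    ‖iteratedFDeriv ℝ n (complexify ∘ u) x‖ ≤ ‖iteratedFDeriv ℝ n u x‖ := by
  rw [iteratedFDeriv_complexify_comp hu n x]
  refine (ContinuousLinearMap.norm_compContinuousMultilinearMap_le _ _).trans ?_
  refine mul_le_of_le_one_left (norm_nonneg _) ?_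
  exact complexify.norm_toContinuousLinearMap_le

/-- Directional iterated derivatives of the complexified field have the same size. [folklore] -/
theorem norm_iteratedFDeriv_complexify_comp_const (hu : ContDiff ℝ (⊤ : ℕ∞) u) (n : ℕ)
    (m x : EuclideanSpace ℝ (Fin 3)) :
    ‖iteratedFDeriv ℝ n (complexify ∘ u) x (fun _ => m)‖ = ‖iteratedFDeriv ℝ n u x (fun _ => m)‖ := by
  rw [iteratedFDeriv_complexify_comp hu n x, ContinuousLinearMap.compContinuousMultilinearMap_coe,
    Function.comp_apply]
  exact norm_complexify _

/-- `∫ ‖Dⁿ(u^ℂ)‖² ≤ ∫ ‖Dⁿu‖²`. [folklore] -/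
theorem lintegral_iteratedFDeriv_complexify_comp_le (hu : ContDiff ℝ (⊤ : ℕ∞) u) (n : ℕ) :
    ∫⁻ x, ‖iteratedFDeriv ℝ n (complexify ∘ u) x‖ₑ ^ 2 ≤ ∫⁻ x, ‖iteratedFDeriv ℝ n u x‖ₑ ^ 2 := by
  refine lintegral_mono fun x => ?_
  gcongr
  rw [← ofReal_norm, ← ofReal_norm]
  exact ENNReal.ofReal_le_ofReal (norm_iteratedFDeriv_complexify_comp_le hu n x)

/-- `∫ ‖Dⁿ(u^ℂ)(m,…,m)‖² ≤ ‖m‖^{2n} ∫ ‖Dⁿu‖²`. [folklore] -/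
theorem lintegral_iteratedFDeriv_complexify_comp_const_le (hu : ContDiff ℝ (⊤ : ℕ∞) u) (n : ℕ)
    (m : EuclideanSpace ℝ (Fin 3)) :
    ∫⁻ x, ‖iteratedFDeriv ℝ n (complexify ∘ u) x (fun _ => m)‖ₑ ^ 2 ≤
      ‖m‖ₑ ^ (2 * n) * ∫⁻ x, ‖iteratedFDeriv ℝ n u x‖ₑ ^ 2 := by
  rw [← lintegral_const_mul' _ _ (by simp [enorm_ne_top])]
  refine lintegral_mono fun x => ?_
  rw [← ofReal_norm, norm_iteratedFDeriv_complexify_comp_const hu n m x, ofReal_norm]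
  have h := norm_iteratedFDeriv_const_le u n m x
  have h' : ‖iteratedFDeriv ℝ n u x (fun _ : Fin n => m)‖ₑ ≤ ‖m‖ₑ ^ n * ‖iteratedFDeriv ℝ n u x‖ₑ := by
    rw [← ofReal_norm, ← ofReal_norm, ← ofReal_norm, ← ENNReal.ofReal_pow (norm_nonneg _),
      ← ENNReal.ofReal_mul (by positivity)]
    exact ENNReal.ofReal_le_ofReal (by rw [mul_comm]; exact h)
  calc ‖iteratedFDeriv ℝ n u x (fun _ : Fin n => m)‖ₑ ^ 2
      ≤ (‖m‖ₑ ^ n * ‖iteratedFDeriv ℝ n u x‖ₑ) ^ 2 := by gcongr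
    _ = ‖m‖ₑ ^ (2 * n) * ‖iteratedFDeriv ℝ n u x‖ₑ ^ 2 := by ring

/-- The complexified field is in `L²` when `u` is. [folklore] -/
theorem memLp_complexify_comp_of_contDiff (hu : ContDiff ℝ (⊤ : ℕ∞) u)
    (h0 : ∫⁻ x, ‖u x‖ₑ ^ 2 < ⊤) : MemLp (complexify ∘ u) 2 (volume : Measure (EuclideanSpace ℝ (Fin 3))) := by
  refine memLp_two_of_continuous_of_lintegral (continuous_complexify.comp hu.continuous) ?_
  refine lt_of_le_of_lt (le_of_eq (lintegral_congr fun x => ?_)) h0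
  rw [Function.comp_apply, ← ofReal_norm, ← ofReal_norm, norm_complexify]

/-- **Fourier–Sobolev norm of a smooth `H^N` field (physical → Fourier transfer)**: for smooth
`u : ℝ³ → ℝ³` with `u, Du, …, D^N u ∈ L²`, `N = n + 1`, the `L²` class of its complexification
has `‖·‖²_{H^N} ≤ 2^N (∫|u|² + 3^N ∫ ‖D^N u‖²)` (Tao's `H¹⁰` norm is the Fourier-side one;
Plancherel on the derivatives). [cite: Tao2016AveragedNS, §1.1 p. 3 (H¹⁰ via Fourier weights)] -/
theorem eFourierSobolevNorm_sq_le (hu : ContDiff ℝ (⊤ : ℕ∞) u) (n : ℕ)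
    (hint : ∀ j ≤ n + 1, ∫⁻ x, ‖iteratedFDeriv ℝ j u x‖ₑ ^ 2 < ⊤)
    (h2 : MemLp (complexify ∘ u) 2 (volume : Measure (EuclideanSpace ℝ (Fin 3)))) :
    eFourierSobolevNorm (n + 1 : ℕ) (h2.toLp _) ^ 2 ≤
      2 ^ (n + 1) * ((∫⁻ x, ‖u x‖ₑ ^ 2) + 3 ^ (n + 1) * ∫⁻ x, ‖iteratedFDeriv ℝ (n + 1) u x‖ₑ ^ 2) := by
  set f : EuclideanSpace ℝ (Fin 3) → EuclideanSpace ℂ (Fin 3) := complexify ∘ u with hf_def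
  have hf : ContDiff ℝ (⊤ : ℕ∞) f := contDiff_complexify_comp hu
  have hintf : ∀ j ≤ n + 1, ∫⁻ x, ‖iteratedFDeriv ℝ j f x‖ₑ ^ 2 < ⊤ := fun j hj =>
    lt_of_le_of_lt (lintegral_iteratedFDeriv_complexify_comp_le hu j) (hint j hj)
  set G : EuclideanSpace ℝ (Fin 3) → EuclideanSpace ℂ (Fin 3) :=
    ((𝓕 (h2.toLp f) : L2C) : EuclideanSpace ℝ (Fin 3) → EuclideanSpace ℂ (Fin 3)) with hG
  have hGm : AEStronglyMeasurable G volume := Lp.aestronglyMeasurable _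
  -- the norm as a weighted integral
  have hnorm : eFourierSobolevNorm (n + 1 : ℕ) (h2.toLp f) ^ 2 =
      ∫⁻ ξ, ENNReal.ofReal ((1 + ‖ξ‖ ^ 2) ^ (n + 1)) * ‖G ξ‖ₑ ^ 2 := by
    rw [eFourierSobolevNorm_eq, ← ENNReal.rpow_natCast, ← ENNReal.rpow_mul,
      show ((1 : ℝ) / 2 * ((2 : ℕ) : ℝ)) = 1 by norm_num, ENNReal.rpow_one]
    unfold sobolevWeightIntegral
    refine lintegral_congr fun ξ => ?_
    rw [Real.rpow_natCast]
    rfl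
  -- Plancherel for `f` itself
  have hP0 : ∫⁻ ξ, ‖G ξ‖ₑ ^ 2 = ∫⁻ x, ‖u x‖ₑ ^ 2 := by
    rw [hG, lintegral_enorm_sq_fourier_eq]
    refine lintegral_congr_ae ?_
    filter_upwards [h2.coeFn_toLp] with x hx
    rw [hx, hf_def, Function.comp_apply, ← ofReal_norm, ← ofReal_norm, norm_complexify]
  -- Plancherel for the coordinate derivatives of order `N`
  have hPi : ∀ i : Fin 3, ∫⁻ ξ, ENNReal.ofReal ((ξ i) ^ (2 * (n + 1))) * ‖G ξ‖ₑ ^ 2 ≤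
      ∫⁻ x, ‖iteratedFDeriv ℝ (n + 1) u x‖ₑ ^ 2 := by
    intro i
    set m : EuclideanSpace ℝ (Fin 3) := EuclideanSpace.single i (1 : ℝ) with hm
    have hW := lintegral_weight_pow_mul_enorm_fourier_sq_eq_of_step
      (fun hg m hg2 hd2 => fourier_toLp_fderiv_ae_eq hg m hg2 hd2) hf m (n + 1) hintf h2
    have hbd := lintegral_iteratedFDeriv_complexify_comp_const_le hu (n + 1) m
    have hnorm1 : ‖(EuclideanSpace.single i (1 : ℝ) : EuclideanSpace ℝ (Fin 3))‖ = 1 := by simp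
    rw [hm, ← ofReal_norm, hnorm1, ENNReal.ofReal_one, one_pow, one_mul, ← hm] at hbd
    refine le_trans ?_ (hW.le.trans hbd)
    refine lintegral_mono fun ξ => ?_
    refine mul_le_mul' ?_ le_rfl
    have hinner : ⟪ξ, EuclideanSpace.single i (1 : ℝ)⟫ = ξ i := by
      rw [EuclideanSpace.inner_single_right]; simp
    rw [hinner, ← ofReal_norm, ← ENNReal.ofReal_pow (norm_nonneg _)]
    refine ENNReal.ofReal_le_ofReal ?_
    rw [norm_pow, norm_mul, Complex.norm_real, Real.norm_eq_abs, ← pow_mul, mul_comm (n + 1) 2,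
      mul_pow]
    have h2π : (1 : ℝ) ≤ ‖2 * (Real.pi : ℂ) * Complex.I‖ ^ (2 * (n + 1)) := by
      refine one_le_pow₀ ?_
      rw [norm_mul, norm_mul, Complex.norm_I, mul_one, Complex.norm_ofNat, Complex.norm_real,
        Real.norm_of_nonneg Real.pi_pos.le]
      linarith [Real.two_le_pi]
    calc (ξ i) ^ (2 * (n + 1)) = |ξ i| ^ (2 * (n + 1)) := by rw [pow_mul, pow_mul, sq_abs]
      _ = 1 * |ξ i| ^ (2 * (n + 1)) := (one_mul _).symm
      _ ≤ ‖2 * (Real.pi : ℂ) * Complex.I‖ ^ (2 * (n + 1)) * |ξ i| ^ (2 * (n + 1)) := by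
          gcongr
  -- assemble
  rw [hnorm]
  calc ∫⁻ ξ, ENNReal.ofReal ((1 + ‖ξ‖ ^ 2) ^ (n + 1)) * ‖G ξ‖ₑ ^ 2
      ≤ ∫⁻ ξ, ENNReal.ofReal (2 ^ (n + 1) * (1 + 3 ^ n * ∑ i, (ξ i) ^ (2 * (n + 1)))) * ‖G ξ‖ₑ ^ 2 := by
        refine lintegral_mono fun ξ => mul_le_mul' (ENNReal.ofReal_le_ofReal (one_add_norm_sq_pow_le n ξ)) le_rfl
    _ = ∫⁻ ξ, (2 ^ (n + 1) * ‖G ξ‖ₑ ^ 2 +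
          ∑ i, 2 ^ (n + 1) * 3 ^ n * (ENNReal.ofReal ((ξ i) ^ (2 * (n + 1))) * ‖G ξ‖ₑ ^ 2)) := by
        refine lintegral_congr fun ξ => ?_
        have hnn : ∀ i : Fin 3, 0 ≤ (ξ i) ^ (2 * (n + 1)) := fun i => by
          rw [pow_mul]; exact pow_nonneg (sq_nonneg _) _
        have hsn : 0 ≤ ∑ i, (ξ i) ^ (2 * (n + 1)) := Finset.sum_nonneg fun i _ => hnn i
        rw [ENNReal.ofReal_mul (by positivity), ENNReal.ofReal_add zero_le_one (by positivity),
          ENNReal.ofReal_one, ENNReal.ofReal_mul (by positivity),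
          ENNReal.ofReal_sum_of_nonneg (fun i _ => hnn i), ENNReal.ofReal_pow (by norm_num),
          ENNReal.ofReal_pow (by norm_num), ENNReal.ofReal_ofNat, ENNReal.ofReal_ofNat]
        rw [mul_add, mul_one, add_mul, Finset.mul_sum, Finset.mul_sum, Finset.sum_mul]
        congr 1
        refine Finset.sum_congr rfl fun i _ => ?_
        ring
    _ = 2 ^ (n + 1) * (∫⁻ ξ, ‖G ξ‖ₑ ^ 2) +
          ∑ i, 2 ^ (n + 1) * 3 ^ n * ∫⁻ ξ, ENNReal.ofReal ((ξ i) ^ (2 * (n + 1))) * ‖G ξ‖ₑ ^ 2 := by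
        have hGe : AEMeasurable (fun ξ => ‖G ξ‖ₑ ^ 2) volume := hGm.enorm.pow_const 2
        have hB : ∀ i : Fin 3, AEMeasurable
            (fun ξ : EuclideanSpace ℝ (Fin 3) => ENNReal.ofReal ((ξ i) ^ (2 * (n + 1))) * ‖G ξ‖ₑ ^ 2)
            volume := fun i =>
          (((EuclideanSpace.proj i).continuous.pow _).measurable.ennreal_ofReal.aemeasurable).mul hGe
        rw [lintegral_add_left' (hGe.const_mul _), lintegral_const_mul'' _ hGe,
          lintegral_finsetSum' _ (fun i _ => (hB i).const_mul _)]
        congr 1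
        refine Finset.sum_congr rfl fun i _ => ?_
        rw [lintegral_const_mul'' _ (hB i)]
    _ ≤ 2 ^ (n + 1) * (∫⁻ x, ‖u x‖ₑ ^ 2) +
          ∑ _i : Fin 3, 2 ^ (n + 1) * 3 ^ n * ∫⁻ x, ‖iteratedFDeriv ℝ (n + 1) u x‖ₑ ^ 2 := by
        rw [hP0]
        refine add_le_add le_rfl (Finset.sum_le_sum fun i _ => ?_)
        exact mul_le_mul_right (hPi i) _
    _ = 2 ^ (n + 1) * ((∫⁻ x, ‖u x‖ₑ ^ 2) + 3 ^ (n + 1) * ∫⁻ x, ‖iteratedFDeriv ℝ (n + 1) u x‖ₑ ^ 2) := by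
        rw [Finset.sum_const, Finset.card_univ, Fintype.card_fin, nsmul_eq_mul, pow_succ]
        push_cast
        ring

/-! ### Divergence-free fields are Fourier-divergence-free; `H¹⁰_df` membership -/

/-- The derivative of the complexified field along `m` is the complexification of `Du(x) m`. [folklore] -/
theorem fderiv_complexify_comp_apply (hu : ContDiff ℝ (⊤ : ℕ∞) u) (x m : EuclideanSpace ℝ (Fin 3)) :
    fderiv ℝ (complexify ∘ u) x m = complexify (fderiv ℝ u x m) := by
  have hd : DifferentiableAt ℝ u x := (hu.differentiable (by simp)).differentiableAt
  have h := (complexify.toContinuousLinearMap.hasFDerivAt.comp x hd.hasFDerivAt).fderiv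
  rw [show (complexify ∘ u) = (⇑complexify.toContinuousLinearMap ∘ u) from rfl, h]
  rfl

/-- The first derivatives of a smooth field with `Du ∈ L²` are in `L²` (complexified). [folklore] -/
theorem memLp_fderiv_complexify_comp (hu : ContDiff ℝ (⊤ : ℕ∞) u)
    (h1 : ∫⁻ x, ‖iteratedFDeriv ℝ 1 u x‖ₑ ^ 2 < ⊤) (m : EuclideanSpace ℝ (Fin 3)) :
    MemLp (fun x => fderiv ℝ (complexify ∘ u) x m) 2 (volume : Measure (EuclideanSpace ℝ (Fin 3))) := by
  have hf : ContDiff ℝ (⊤ : ℕ∞) (complexify ∘ u) := contDiff_complexify_comp hu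
  have h1f : ∫⁻ x, ‖iteratedFDeriv ℝ 1 (complexify ∘ u) x‖ₑ ^ 2 < ⊤ :=
    lt_of_le_of_lt (lintegral_iteratedFDeriv_complexify_comp_le hu 1) h1
  have h := memLp_iteratedFDeriv_const hf h1f m
  refine h.ae_eq (Eventually.of_forall fun x => ?_)
  exact iteratedFDeriv_one_apply (fun _ : Fin 1 => m)

/-- **Divergence-free fields are Fourier-divergence-free**: for smooth `u : ℝ³ → ℝ³` with
`div u = 0` and `u, Du ∈ L²`, the `L²` class of its complexification satisfies `ξ · û(ξ) = 0`
for a.e. `ξ` (Tao 2016, p. 3: "the divergence-free condition ensures that `û(ξ₁) ∈ ξ₁^⊥` for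
(almost) all `ξ₁`"). [cite: Tao2016AveragedNS, §1.1 p. 3] -/
theorem isFourierDivFree_toLp_complexify (hu : ContDiff ℝ (⊤ : ℕ∞) u)
    (hdiv : VectorCalculus.IsDivFree u) (h1 : ∫⁻ x, ‖iteratedFDeriv ℝ 1 u x‖ₑ ^ 2 < ⊤)
    (h2 : MemLp (complexify ∘ u) 2 (volume : Measure (EuclideanSpace ℝ (Fin 3)))) :
    IsFourierDivFree (h2.toLp _) := by
  set f : EuclideanSpace ℝ (Fin 3) → EuclideanSpace ℂ (Fin 3) := complexify ∘ u with hf_def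
  have hf : ContDiff ℝ (⊤ : ℕ∞) f := contDiff_complexify_comp hu
  have hf1 : ContDiff ℝ 1 f := hf.of_le (by exact_mod_cast le_top)
  set e : Fin 3 → EuclideanSpace ℝ (Fin 3) := fun i => EuclideanSpace.single i (1 : ℝ) with he
  have hD : ∀ i, MemLp (fun x => fderiv ℝ f x (e i)) 2 (volume : Measure (EuclideanSpace ℝ (Fin 3))) :=
    fun i => memLp_fderiv_complexify_comp hu h1 (e i)
  set P : Fin 3 → (EuclideanSpace ℂ (Fin 3) →L[ℂ] ℂ) := fun i => EuclideanSpace.proj i with hP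
  set v : Fin 3 → Lp ℂ 2 (volume : Measure (EuclideanSpace ℝ (Fin 3))) :=
    fun i => (P i).compLp ((hD i).toLp _) with hv
  -- the coefficients of the divergence sum to zero
  have hvi : ∀ i, (v i : EuclideanSpace ℝ (Fin 3) → ℂ) =ᵐ[volume] fun x => ((fderiv ℝ u x (e i) i : ℝ) : ℂ) := by
    intro i
    filter_upwards [ContinuousLinearMap.coeFn_compLp (P i) ((hD i).toLp _), (hD i).coeFn_toLp] with x hx hx'
    rw [hv]
    dsimp only
    rw [hx, hx', hP]
    dsimp only
    rw [hf_def, fderiv_complexify_comp_apply hu]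
    simp only [PiLp.proj_apply, complexify_apply]
  have hsum : v 0 + v 1 + v 2 = 0 := by
    refine Lp.eq_zero_iff_ae_eq_zero.2 ?_
    filter_upwards [Lp.coeFn_add (v 0 + v 1) (v 2), Lp.coeFn_add (v 0) (v 1), hvi 0, hvi 1, hvi 2]
      with x h01_2 h0_1 h0 h1' h2'
    rw [h01_2, Pi.add_apply, h0_1, Pi.add_apply, h0, h1', h2', Pi.zero_apply]
    have hx := hdiv x
    rw [divergence_eq_sum_inner_fderiv (EuclideanSpace.basisFun (Fin 3) ℝ), Fin.sum_univ_three] at hx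
    simp only [EuclideanSpace.basisFun_apply, EuclideanSpace.inner_single_left, map_one, one_mul] at hx
    exact_mod_cast hx
  -- apply the Fourier transform
  have hFsum : (𝓕 (v 0) : Lp ℂ 2 (volume : Measure (EuclideanSpace ℝ (Fin 3)))) + 𝓕 (v 1) + 𝓕 (v 2) = 0 := by
    rw [← FourierTransform.fourier_add, ← FourierTransform.fourier_add, hsum, FourierTransform.fourier_zero]
  have hC : ∀ i, ((𝓕 (v i) : Lp ℂ 2 (volume : Measure (EuclideanSpace ℝ (Fin 3)))) :
      EuclideanSpace ℝ (Fin 3) → ℂ) =ᵐ[volume]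
        fun ξ => (2 * Real.pi * Complex.I) * ((ξ i : ℝ) : ℂ) * fourierFn (h2.toLp f) ξ i := by
    intro i
    filter_upwards [fourier_compLp_ae_eq (P i) ((hD i).toLp _),
      fourier_toLp_fderiv_ae_eq hf1 (e i) h2 (hD i)] with ξ hξ hξ'
    rw [hv]
    dsimp only
    rw [hξ, hξ', hP]
    dsimp only
    have hinner : ∀ (η : EuclideanSpace ℝ (Fin 3)) (j : Fin 3), ⟪η, EuclideanSpace.single j (1 : ℝ)⟫ = η j :=
      fun η j => by rw [EuclideanSpace.inner_single_right]; simp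
    simp only [PiLp.proj_apply, PiLp.smul_apply, smul_eq_mul, he, hinner]
    rfl
  unfold IsFourierDivFree
  filter_upwards [Lp.coeFn_add ((𝓕 (v 0) : Lp ℂ 2 (volume : Measure (EuclideanSpace ℝ (Fin 3)))) + 𝓕 (v 1))
      (𝓕 (v 2)), Lp.coeFn_add (𝓕 (v 0) : Lp ℂ 2 (volume : Measure (EuclideanSpace ℝ (Fin 3)))) (𝓕 (v 1)),
    hC 0, hC 1, hC 2,
    Lp.coeFn_zero ℂ 2 (volume : Measure (EuclideanSpace ℝ (Fin 3))),
    (Lp.ext_iff.1 hFsum)] with ξ h01_2 h0_1 h0 h1' h2' hz hF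
  rw [h01_2, Pi.add_apply, h0_1, Pi.add_apply, h0, h1', h2', hz, Pi.zero_apply] at hF
  have h2πI : (2 * Real.pi * Complex.I : ℂ) ≠ 0 := by
    simp [Real.pi_ne_zero, Complex.I_ne_zero]
  unfold cdot
  rw [Fin.sum_univ_three, complexify_apply, complexify_apply, complexify_apply]
  have : (2 * Real.pi * Complex.I) * (((ξ 0 : ℝ) : ℂ) * fourierFn (h2.toLp f) ξ 0 +
      ((ξ 1 : ℝ) : ℂ) * fourierFn (h2.toLp f) ξ 1 + ((ξ 2 : ℝ) : ℂ) * fourierFn (h2.toLp f) ξ 2) = 0 := by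
    rw [← hF]; ring
  exact (mul_eq_zero.1 this).resolve_left h2πI

/-- The `L²` class of a real field is real. [folklore] -/
theorem isReal_toLp_complexify (h2 : MemLp (complexify ∘ u) 2 (volume : Measure (EuclideanSpace ℝ (Fin 3)))) :
    IsReal (h2.toLp _) := by
  unfold IsReal
  filter_upwards [h2.coeFn_toLp] with x hx
  intro i
  rw [hx, Function.comp_apply, complexify_apply, Complex.ofReal_im]

/-- **`H¹⁰_df` membership of smooth divergence-free `H¹⁰` fields**: for smooth `u : ℝ³ → ℝ³` with
`div u = 0` and `u, Du, …, D¹⁰u ∈ L²`, the `L²` class of its complexification lies in Tao's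
`H¹⁰_df(ℝ³)` (`MemH10df`). [cite: Tao2016AveragedNS, §1.1 p. 3] -/
theorem memH10df_toLp_complexify (hu : ContDiff ℝ (⊤ : ℕ∞) u) (hdiv : VectorCalculus.IsDivFree u)
    (hint : ∀ j ≤ 10, ∫⁻ x, ‖iteratedFDeriv ℝ j u x‖ₑ ^ 2 < ⊤)
    (h2 : MemLp (complexify ∘ u) 2 (volume : Measure (EuclideanSpace ℝ (Fin 3)))) :
    MemH10df (h2.toLp _) := by
  refine ⟨?_, isReal_toLp_complexify h2, isFourierDivFree_toLp_complexify hu hdiv (hint 1 (by norm_num)) h2⟩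
  have h := eFourierSobolevNorm_sq_le hu 9 hint h2
  have h0 : ∫⁻ x, ‖u x‖ₑ ^ 2 < ⊤ := by
    have h0' := hint 0 (by norm_num)
    have he : ∀ x, ‖iteratedFDeriv ℝ 0 u x‖ₑ = ‖u x‖ₑ := fun x => by
      rw [← ofReal_norm, norm_iteratedFDeriv_zero, ofReal_norm]
    simp_rw [he] at h0'
    exact h0'
  have hfin : eFourierSobolevNorm ((9 : ℕ) + 1 : ℕ) (h2.toLp _) ^ 2 < ⊤ := by
    refine lt_of_le_of_lt h ?_
    refine ENNReal.mul_lt_top (ENNReal.pow_lt_top (by simp)) ?_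
    exact ENNReal.add_lt_top.2 ⟨h0, ENNReal.mul_lt_top (ENNReal.pow_lt_top (by simp)) (hint 10 le_rfl)⟩
  have hfin' : eFourierSobolevNorm ((9 : ℕ) + 1 : ℕ) (h2.toLp _) < ⊤ := by
    by_contra hc
    rw [not_lt, top_le_iff] at hc
    rw [hc] at hfin
    simp at hfin
  convert hfin' using 2
  norm_num

end R3
end Summit.NavierStokesRegularity.NavierStokesRegularity.Theorems.PerpetualPumpEulerTypeIGlue

end
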